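import Mathlib
import Summits.Ventures.PercRepro2.SwOutArmThm

/-!
# THE ARM PRINCIPLE FOR THE ASYMMETRIC SIDE (blind cell PercRepro2, night-4 g30, 2026-08-28;
proofs/NIGHT4-G30.md §7)

For two UP-SETS `𝓤₁, 𝓤₂` of vertex sets, the ASYMMETRIC side is
`T(𝓤₁, 𝓤₂) = tgtU2 ends l h 𝓤₁ 𝓤₂ = {h ∉ H_l, C_R(l) ∈ 𝓤₁, C_B(l) ∉ 𝓤₂}`; with `𝓤₁ = 𝓤₂` it is the
side `tgtU ends l h 𝓤` of the rows of record (`tgtU2_self`), with `𝓤₁ = 𝓤₂ = {S ∣ o ∈ S}` the side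
`Q_o` of row 2′SW-ALL.  The ASYMMETRIC DOMINATION (a candidate row: on `T(𝓤₁, 𝓤₂)` the blue edge
set of `h` dominates the red one in the rigid form, `SwAll2`) enters g10's arm principle ONLY
through the monotonicity of the conditioning along an arm flip — flipping red arms to blue
enlarges `C_R(l)`, shrinks `C_B(l)` and keeps `h` off both — and an up-set condition on `C_R(l)`,
a co-up-set condition on `C_B(l)`, are exactly what that monotonicity preserves
(`flip_mem_tgtU2_of_armClosed_red`, `orbitReal_mem_tgtU2_of_le`).  Hence the arm principle
holds on the asymmetric side verbatim: `card_orbit_le2` (every orbit of the arm flips),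
`card_coreFree_le2` (the core-free part of every outside class), `rigidOK2_of_coreFree`,
`rigidOK2_of_outEdges'` (regions whose vertices other than `h` carry an outside edge, or no edge,
or are forced into `C_R(l)` by `𝓤₁` — the role of the mark), and on the whole graph
**`card_le_asym_of_outEdges`** / **`swAll2_of_outEdges`**: the asymmetric domination on every
graph in which every vertex other than `l, h` is joined to `l`, or isolated, or forced by `𝓤₁`,
for EVERY pair of up-sets — the first kernel theorem of the candidate row (the g10 class).
-/

namespace Summit.Ventures.PercRepro2

namespace LocRows

open Hull

variable {V : Type*} {E : Type*} [Fintype E] [DecidableEq E]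

open scoped Classical

variable {ends : E → Sym2 V}

section Side

variable (ends)

/-- The ASYMMETRIC side `T(𝓤₁, 𝓤₂) = {h ∉ H_l, C_R(l) ∈ 𝓤₁, C_B(l) ∉ 𝓤₂}`. -/
noncomputable def tgtU2 (l h : V) (𝓤₁ 𝓤₂ : Set (Set V)) : Finset (Config E) :=
  Finset.univ.filter fun ζ =>
    h ∉ hull ends ζ l ∧ cluster ends ζ l ∈ 𝓤₁ ∧ cluster ends (blue ζ) l ∉ 𝓤₂

/-- `T(𝓤₁, 𝓤₂) ∩ outClass`. -/
noncomputable def swOutSide2 (l h : V) (𝓤₁ 𝓤₂ : Set (Set V)) (U : Set V) (ξ : Config E) :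
    Finset (Config E) :=
  tgtU2 ends l h 𝓤₁ 𝓤₂ ∩ outClass ends U h ξ

/-- The core-free part of the asymmetric side of a class. -/
noncomputable def coreFreePart2 (l h : V) (𝓤₁ 𝓤₂ : Set (Set V)) (U : Set V) (ξ : Config E) :
    Finset (Config E) :=
  (swOutSide2 ends l h 𝓤₁ 𝓤₂ U ξ).filter fun ζ => CoreFree ends ζ h

/-- **The asymmetric domination, rigid form** (`SwAll` with two up-sets): an injection of
`T(𝓤₁, 𝓤₂)` into itself under which every red edge inside the red cluster of `h` of the source is
blue in the image. -/
def SwAll2 (l h : V) (𝓤₁ 𝓤₂ : Set (Set V)) : Prop :=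
  ∃ f : {ζ // ζ ∈ tgtU2 ends l h 𝓤₁ 𝓤₂} → Config E, Function.Injective f ∧
    ∀ x, f x ∈ tgtU2 ends l h 𝓤₁ 𝓤₂ ∧
      ∀ e, e ∈ within ends (cluster ends x.1 h) → x.1 e = true → f x e = false

variable {ends}

/-- Membership in the asymmetric side. -/
lemma mem_tgtU2 {l h : V} {𝓤₁ 𝓤₂ : Set (Set V)} {ζ : Config E} :
    ζ ∈ tgtU2 ends l h 𝓤₁ 𝓤₂ ↔
      h ∉ hull ends ζ l ∧ cluster ends ζ l ∈ 𝓤₁ ∧ cluster ends (blue ζ) l ∉ 𝓤₂ := by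
  simp only [tgtU2, Finset.mem_filter, Finset.mem_univ, true_and]

/-- With one up-set the asymmetric side is the side of the rows of record. -/
lemma tgtU2_self (l h : V) (𝓤 : Set (Set V)) : tgtU2 ends l h 𝓤 𝓤 = tgtU ends l h 𝓤 := rfl

/-- Membership in `swOutSide2`. -/
lemma mem_swOutSide2 {l h : V} {𝓤₁ 𝓤₂ : Set (Set V)} {U : Set V} {ξ ζ : Config E} :
    ζ ∈ swOutSide2 ends l h 𝓤₁ 𝓤₂ U ξ ↔
      ζ ∈ tgtU2 ends l h 𝓤₁ 𝓤₂ ∧ ζ ∈ outClass ends U h ξ := by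
  simp only [swOutSide2, Finset.mem_inter]

/-- On the asymmetric side the hull of `h` avoids `l`. -/
lemma l_notMem_hull_of_mem_tgtU2 {l h : V} {𝓤₁ 𝓤₂ : Set (Set V)} {ζ : Config E}
    (hζ : ζ ∈ tgtU2 ends l h 𝓤₁ 𝓤₂) : l ∉ hull ends ζ h := by
  rw [mem_tgtU2] at hζ
  intro hl
  apply hζ.1
  rcases hl with hl | hl
  · exact Or.inl (conn_symm hl)
  · exact Or.inr (conn_symm hl)

end Side

section Flip

variable {ζ : Config E} {h : V} {P : Set V}

/-- **Flipping red arms to blue keeps the asymmetric side**: the red cluster of `l` grows (an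
up-set condition survives), the blue one shrinks (a co-up-set condition survives), `h` stays
disconnected from `l`. -/
theorem flip_mem_tgtU2_of_armClosed_red {U : Set V} {l : V} {𝓤₁ 𝓤₂ : Set (Set V)}
    (h𝓤₁ : IsUpperSet 𝓤₁) (h𝓤₂ : IsUpperSet 𝓤₂) (hc : CoreFree ends ζ h)
    (hP : ArmClosed ends ζ h P) (hPT : P ⊆ cluster ends ζ h) (hUP : P ⊆ U) (hl : l ∉ U)
    (hQ : ζ ∈ tgtU2 ends l h 𝓤₁ 𝓤₂) : flip ends P ζ ∈ tgtU2 ends l h 𝓤₁ 𝓤₂ := by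
  have hlP : l ∉ P := fun h' => hl (hUP h')
  rw [mem_tgtU2] at hQ ⊢
  simp only [hull, Set.mem_union, not_or] at hQ ⊢
  obtain ⟨⟨hhA, hhB⟩, hA, hB⟩ := hQ
  refine ⟨⟨h_notMem_cluster_flip_of_armClosed_red hc hP hPT hhA, ?_⟩, ?_, ?_⟩
  · exact fun h' => hhB (cluster_blue_flip_subset_of_armClosed_red hc hP hPT hlP hhB h')
  · exact h𝓤₁ (cluster_l_subset_flip_of_armClosed_red hPT hlP hhA) hA
  · exact fun h' => hB (h𝓤₂ (cluster_blue_flip_subset_of_armClosed_red hc hP hPT hlP hhB) h')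

end Flip

section OrbitCube

variable {ζ : Config E} {h : V} (hc : CoreFree ends ζ h)
include hc

/-- **The asymmetric conditioning pulls back to a lower set of the orbit cube.** -/
theorem orbitReal_mem_tgtU2_of_le {U : Set V} {ξ : Config E} {l : V} {𝓤₁ 𝓤₂ : Set (Set V)}
    (h𝓤₁ : IsUpperSet 𝓤₁) (h𝓤₂ : IsUpperSet 𝓤₂)
    (hζ : ζ ∈ outClass ends U h ξ) (hl : l ∉ U) {ω ω' : Config (arms ends ζ h)} (hω : ω ≤ ω')
    (hQ : orbitReal ends ζ h ω' ∈ tgtU2 ends l h 𝓤₁ 𝓤₂) :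
    orbitReal ends ζ h ω ∈ tgtU2 ends l h 𝓤₁ 𝓤₂ := by
  rw [orbitReal_eq_flip_of_le hω]
  have hD : ArmClosed ends (orbitReal ends ζ h ω') h
      {x | ∃ P : arms ends ζ h, (ω P = false ∧ ω' P = true) ∧ x ∈ P.1} :=
    armClosed_of_hull_eq (hull_orbitReal hc ω') (armClosed_armsSel _)
  refine flip_mem_tgtU2_of_armClosed_red h𝓤₁ h𝓤₂ (coreFree_orbitReal hc ω') hD ?_ ?_ hl hQ
  · rintro x ⟨P, hP, hxP⟩
    rw [cluster_orbitReal hc]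
    refine ⟨(mem_hull_sdiff_of_mem_arms P.2 hxP).1, ?_⟩
    rintro ⟨Q, hQ, hxQ⟩
    have : Q = P := Subtype.ext (arms_eq_of_mem Q.2 P.2 hxQ hxP)
    subst this
    rw [hP.2] at hQ; exact absurd hQ (by decide)
  · rintro x ⟨P, _, hxP⟩
    exact (mem_outClass.1 hζ).2 (mem_hull_sdiff_of_mem_arms P.2 hxP).1

/-- **The rigid counting inequality on an orbit, asymmetric side.** -/
theorem card_orbit_le2 (hloop : ∀ e, ends e ≠ s(h, h)) {U : Set V} {ξ : Config E} {l : V}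
    {𝓤₁ 𝓤₂ : Set (Set V)} (h𝓤₁ : IsUpperSet 𝓤₁) (h𝓤₂ : IsUpperSet 𝓤₂)
    (hζ : ζ ∈ outClass ends U h ξ) (hl : l ∉ U) {𝓔 : Set (Set E)} (h𝓔 : IsUpperSet 𝓔) :
    ((orbit ends ζ h).filter fun ζ' =>
        ζ' ∈ tgtU2 ends l h 𝓤₁ 𝓤₂ ∧ redEdges ends ζ' h ∈ 𝓔).card ≤
      ((orbit ends ζ h).filter fun ζ' =>
        ζ' ∈ tgtU2 ends l h 𝓤₁ 𝓤₂ ∧ blueEdges ends ζ' h ∈ 𝓔).card := by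
  have key := card_le_of_cube_edges (ends := ends) (orbitReal ends ζ h) orbitReal_injective
    (orbit ends ζ h) (fun ζ' => by simp only [orbit, Finset.mem_image, Finset.mem_univ, true_and])
    (↑(tgtU2 ends l h 𝓤₁ 𝓤₂))
    (fun ω' ω hω hQ => orbitReal_mem_tgtU2_of_le hc h𝓤₁ h𝓤₂ hζ hl hω hQ) h
    (fun 𝓔' h𝓔' ω ω' hω hω𝓔 => h𝓔' (redEdges_orbitReal_mono hc hω) hω𝓔)
    (fun 𝓔' h𝓔' ω' ω hω hω𝓔 => h𝓔' (blueEdges_orbitReal_anti hc hloop hω) hω𝓔)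
    (fun ω => blueEdges_orbitReal_flipAll hc hloop ω) h𝓔
  simpa only [Finset.mem_coe] using key

end OrbitCube

section Sum

variable {U : Set V} {ξ : Config E} {l h : V} {𝓤₁ 𝓤₂ : Set (Set V)}

/-- **THE ARM PRINCIPLE, ASYMMETRIC SIDE**: the core-free part of every class satisfies the rigid
counting inequality on `T(𝓤₁, 𝓤₂)` (no loop at `h`). -/
theorem card_coreFree_le2 (h𝓤₁ : IsUpperSet 𝓤₁) (h𝓤₂ : IsUpperSet 𝓤₂) (hl : l ∉ U)
    (hloop : ∀ e, ends e ≠ s(h, h)) {𝓔 : Set (Set E)} (h𝓔 : IsUpperSet 𝓔) :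
    ((coreFreePart2 ends l h 𝓤₁ 𝓤₂ U ξ).filter fun ζ => redEdges ends ζ h ∈ 𝓔).card ≤
      ((coreFreePart2 ends l h 𝓤₁ 𝓤₂ U ξ).filter fun ζ => blueEdges ends ζ h ∈ 𝓔).card := by
  let can : Config E → Config E := fun ζ => allRed ends ζ h
  let S₀ : Finset (Config E) := (coreFreePart2 ends l h 𝓤₁ 𝓤₂ U ξ).image can
  have hmapR : ∀ ζ ∈ (coreFreePart2 ends l h 𝓤₁ 𝓤₂ U ξ).filter fun ζ => redEdges ends ζ h ∈ 𝓔,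
      can ζ ∈ S₀ := fun ζ hζ => Finset.mem_image_of_mem can (Finset.mem_filter.1 hζ).1
  have hmapB : ∀ ζ ∈ (coreFreePart2 ends l h 𝓤₁ 𝓤₂ U ξ).filter fun ζ => blueEdges ends ζ h ∈ 𝓔,
      can ζ ∈ S₀ := fun ζ hζ => Finset.mem_image_of_mem can (Finset.mem_filter.1 hζ).1
  rw [Finset.card_eq_sum_card_fiberwise hmapR, Finset.card_eq_sum_card_fiberwise hmapB]
  refine Finset.sum_le_sum fun ζ₀ hζ₀ => ?_
  obtain ⟨ζ₁, hζ₁, rfl⟩ := Finset.mem_image.1 hζ₀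
  have hζ₁' := Finset.mem_filter.1 hζ₁
  have hc₁ : CoreFree ends ζ₁ h := hζ₁'.2
  have hcl₁ : ζ₁ ∈ outClass ends U h ξ := (mem_swOutSide2.1 hζ₁'.1).2
  have hc₀ : CoreFree ends (allRed ends ζ₁ h) h := coreFree_allRed hc₁
  have hcl₀ : allRed ends ζ₁ h ∈ outClass ends U h ξ := allRed_mem_outClass hcl₁ hc₁
  have hfib : ∀ P : Config E → Prop,
      ((coreFreePart2 ends l h 𝓤₁ 𝓤₂ U ξ).filter fun ζ => P ζ).filter (fun ζ => can ζ = can ζ₁) =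
        (orbit ends (allRed ends ζ₁ h) h).filter fun ζ' =>
          ζ' ∈ tgtU2 ends l h 𝓤₁ 𝓤₂ ∧ P ζ' := by
    intro P
    ext ζ'
    simp only [Finset.mem_filter, coreFreePart2, orbit, Finset.mem_image, Finset.mem_univ,
      true_and, mem_swOutSide2, can]
    constructor
    · rintro ⟨⟨⟨⟨hQ, _⟩, hc'⟩, hP⟩, hcan⟩
      obtain ⟨ω, hω⟩ := exists_orbitReal_eq hc' hcan
      exact ⟨⟨ω, hω⟩, hQ, hP⟩
    · rintro ⟨⟨ω, rfl⟩, hQ, hP⟩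
      refine ⟨⟨⟨⟨hQ, orbitReal_mem_outClass hc₀ hcl₀ ω⟩, coreFree_orbitReal hc₀ ω⟩, hP⟩, ?_⟩
      rw [allRed_orbitReal hc₀ ω, allRed_idem hc₁]
  rw [hfib, hfib]
  exact card_orbit_le2 hc₀ hloop h𝓤₁ h𝓤₂ hcl₀ hl h𝓔

/-- **A class all of whose `T`-configurations are core-free satisfies the rigid inequality on the
asymmetric side.** -/
theorem rigidOK2_of_coreFree (h𝓤₁ : IsUpperSet 𝓤₁) (h𝓤₂ : IsUpperSet 𝓤₂) (hl : l ∉ U)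
    (hloop : ∀ e, ends e ≠ s(h, h))
    (hcf : ∀ ζ ∈ swOutSide2 ends l h 𝓤₁ 𝓤₂ U ξ, CoreFree ends ζ h) {𝓔 : Set (Set E)}
    (h𝓔 : IsUpperSet 𝓔) :
    ((swOutSide2 ends l h 𝓤₁ 𝓤₂ U ξ).filter fun ζ => redEdges ends ζ h ∈ 𝓔).card ≤
      ((swOutSide2 ends l h 𝓤₁ 𝓤₂ U ξ).filter fun ζ => blueEdges ends ζ h ∈ 𝓔).card := by
  have heq : coreFreePart2 ends l h 𝓤₁ 𝓤₂ U ξ = swOutSide2 ends l h 𝓤₁ 𝓤₂ U ξ := by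
    ext ζ
    simp only [coreFreePart2, Finset.mem_filter]
    exact ⟨fun h' => h'.1, fun h' => ⟨h', hcf ζ h'⟩⟩
  have := card_coreFree_le2 (ends := ends) (ξ := ξ) h𝓤₁ h𝓤₂ hl hloop h𝓔
  rw [heq] at this
  exact this

/-- When every vertex of `U ∖ {h}` is forced into `C_R(l)` by `𝓤₁`, or has an outside edge, or
no edge at all, every `T`-configuration of the class is core-free (a core carries no outside
edge; a core in `C_R(l)` joins `h` to `l`). -/
theorem coreFree_of_outEdges2 (hout : ∀ x ∈ U, x ≠ h →
      (∀ S ∈ 𝓤₁, x ∈ S) ∨ (∃ e y, ends e = s(x, y) ∧ y ∉ U) ∨ (∀ e, x ∉ ends e)) {ζ : Config E}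
    (hζ : ζ ∈ swOutSide2 ends l h 𝓤₁ 𝓤₂ U ξ) : CoreFree ends ζ h := by
  intro x hxT hxTp
  by_contra hxh
  have hQ := (mem_swOutSide2.1 hζ).1
  have hcl := (mem_swOutSide2.1 hζ).2
  rw [mem_tgtU2] at hQ
  simp only [hull, Set.mem_union, not_or] at hQ
  obtain ⟨⟨hhA, _⟩, hA, _⟩ := hQ
  have hxU : x ∈ U := (mem_outClass.1 hcl).2 (Or.inl hxT)
  rcases hout x hxU hxh with hforce | ⟨e, y, hxy, hyU⟩ | hiso
  · exact hhA (conn_trans (hforce _ hA) (conn_symm hxT))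
  · cases he : ζ e with
    | true => exact hyU ((mem_outClass.1 hcl).2 (Or.inl (mem_cluster_of_edge hxT he hxy)))
    | false =>
      have he' : blue ζ e = true := by rw [blue_eq_true_iff]; exact he
      exact hyU ((mem_outClass.1 hcl).2 (Or.inr (mem_cluster_of_edge hxTp he' hxy)))
  · obtain ⟨e, hxe⟩ := exists_edge_of_mem_cluster hxT hxh
    exact hiso e hxe

/-- **The rigid inequality on the asymmetric side of every class of a region whose vertices other
than `h` are forced by `𝓤₁`, carry an outside edge, or carry no edge** (no loop at `h`). -/
theorem rigidOK2_of_outEdges' (h𝓤₁ : IsUpperSet 𝓤₁) (h𝓤₂ : IsUpperSet 𝓤₂) (hl : l ∉ U)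
    (hloop : ∀ e, ends e ≠ s(h, h))
    (hout : ∀ x ∈ U, x ≠ h →
      (∀ S ∈ 𝓤₁, x ∈ S) ∨ (∃ e y, ends e = s(x, y) ∧ y ∉ U) ∨ (∀ e, x ∉ ends e))
    {𝓔 : Set (Set E)} (h𝓔 : IsUpperSet 𝓔) :
    ((swOutSide2 ends l h 𝓤₁ 𝓤₂ U ξ).filter fun ζ => redEdges ends ζ h ∈ 𝓔).card ≤
      ((swOutSide2 ends l h 𝓤₁ 𝓤₂ U ξ).filter fun ζ => blueEdges ends ζ h ∈ 𝓔).card :=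
  rigidOK2_of_coreFree h𝓤₁ h𝓤₂ hl hloop (fun _ hζ => coreFree_of_outEdges2 hout hζ) h𝓔

end Sum

section Graph

variable {l h : V} {𝓤₁ 𝓤₂ : Set (Set V)}

/-- **The asymmetric domination on a graph whose vertices other than `l, h` are forced by `𝓤₁`,
joined to `l`, or isolated** (no loop at `h`): the counting form, for every pair of up-sets. The
classes of the region `{l}ᶜ` are indexed by the colouring of the loops at `l` and partition the
side. -/
theorem card_le_asym_of_outEdges (hlh : l ≠ h) (hloop : ∀ e, ends e ≠ s(h, h))
    (h𝓤₁ : IsUpperSet 𝓤₁) (h𝓤₂ : IsUpperSet 𝓤₂)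
    (hout : ∀ x, x ≠ l → x ≠ h →
      (∀ S ∈ 𝓤₁, x ∈ S) ∨ (∃ e, ends e = s(x, l)) ∨ (∀ e, x ∉ ends e))
    (𝓔 : Set (Set E)) (h𝓔 : IsUpperSet 𝓔) :
    ((tgtU2 ends l h 𝓤₁ 𝓤₂).filter fun ζ => redEdges ends ζ h ∈ 𝓔).card ≤
      ((tgtU2 ends l h 𝓤₁ 𝓤₂).filter fun ζ => blueEdges ends ζ h ∈ 𝓔).card := by
  have hl : l ∉ ({l}ᶜ : Set V) := by simp
  set T := tgtU2 ends l h 𝓤₁ 𝓤₂ with hT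
  let can : Config E → Config E := outRep ends ({l}ᶜ)
  have hmapR : ∀ ζ ∈ T.filter fun ζ => redEdges ends ζ h ∈ 𝓔, can ζ ∈ T.image can :=
    fun ζ hζ => Finset.mem_image_of_mem can (Finset.mem_filter.1 hζ).1
  have hmapB : ∀ ζ ∈ T.filter fun ζ => blueEdges ends ζ h ∈ 𝓔, can ζ ∈ T.image can :=
    fun ζ hζ => Finset.mem_image_of_mem can (Finset.mem_filter.1 hζ).1
  rw [Finset.card_eq_sum_card_fiberwise hmapR, Finset.card_eq_sum_card_fiberwise hmapB]
  refine Finset.sum_le_sum fun ξ hξ => ?_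
  obtain ⟨ζ₀, -, rfl⟩ := Finset.mem_image.1 hξ
  have hidem : ∀ ζ : Config E, outRep ends ({l}ᶜ) (outRep ends ({l}ᶜ) ζ) = outRep ends ({l}ᶜ) ζ := by
    intro ζ; funext e; simp only [outRep]; split_ifs <;> rfl
  -- the fibre over a representative is the asymmetric side of its class
  have hfib : ∀ P : Config E → Prop,
      (T.filter fun ζ => P ζ).filter (fun ζ => can ζ = can ζ₀) =
        (swOutSide2 ends l h 𝓤₁ 𝓤₂ ({l}ᶜ) (can ζ₀)).filter fun ζ => P ζ := by
    intro P
    ext ζ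
    simp only [Finset.mem_filter, mem_swOutSide2, mem_outClass, hT]
    constructor
    · rintro ⟨⟨hζ, hP⟩, hcan⟩
      refine ⟨⟨hζ, ?_, ?_⟩, hP⟩
      · intro e he
        rw [← hcan]
        simp only [can, outRep, he, if_false]
      · intro x hx hxl
        simp only [Set.mem_singleton_iff] at hxl
        subst hxl
        exact l_notMem_hull_of_mem_tgtU2 hζ hx
    · rintro ⟨⟨hζ, hagree, -⟩, hP⟩
      refine ⟨⟨hζ, hP⟩, ?_⟩
      show outRep ends ({l}ᶜ) ζ = outRep ends ({l}ᶜ) ζ₀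
      rw [outRep_eq_of_agree (ends := ends) (U := {l}ᶜ) (ζ := outRep ends ({l}ᶜ) ζ₀) (ζ' := ζ) hagree,
        hidem]
  rw [hfib, hfib]
  refine rigidOK2_of_outEdges' h𝓤₁ h𝓤₂ hl hloop ?_ h𝓔
  intro x hx hxh
  rcases hout x (by simpa using hx) hxh with hf | ⟨e, he⟩ | hiso
  · exact Or.inl hf
  · exact Or.inr (Or.inl ⟨e, l, he, by simp⟩)
  · exact Or.inr (Or.inr hiso)

/-- **The asymmetric domination, rigid injection form, on the same graphs** (Hall). -/
theorem swAll2_of_outEdges (hlh : l ≠ h) (hloop : ∀ e, ends e ≠ s(h, h))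
    (h𝓤₁ : IsUpperSet 𝓤₁) (h𝓤₂ : IsUpperSet 𝓤₂)
    (hout : ∀ x, x ≠ l → x ≠ h →
      (∀ S ∈ 𝓤₁, x ∈ S) ∨ (∃ e, ends e = s(x, l)) ∨ (∀ e, x ∉ ends e)) :
    SwAll2 ends l h 𝓤₁ 𝓤₂ :=
  exists_swAll_injection_of_card_le h _ (card_le_asym_of_outEdges hlh hloop h𝓤₁ h𝓤₂ hout)

/-- With one up-set `SwAll2` is the rigid row on the side `tgtU`; at a principal up-set it is row
2′SW-ALL: `swAll2_of_outEdges` at `𝓤₁ = 𝓤₂ = {S ∣ o ∈ S}` recovers g10's graph class. -/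
theorem swAll_of_swAll2 {o : V} (hs : SwAll2 ends l h {S : Set V | o ∈ S} {S : Set V | o ∈ S}) :
    SwAll ends l h o := hs

end Graph

end LocRows

end Summit.Ventures.PercRepro2

/-! ## ERRATUM (night-4 g30, 2026-08-28T17:5xZ; proofs/NIGHT4-G30.md §9)

The «asymmetric domination» of the header is NOT a new candidate: `tgtU2 ends l h 𝓤₁ 𝓤₂` is the
typed class `typedQ ends l h 𝓤₁ 𝓤₂ᶜ` of night-4 g6's TYPED RIGID ROW (`TypedSwAll`, TypedRow.lean;
NIGHT4-G6.md §13–§14), the rectangle case of night-4 g9's master form (M) (`SwMaster`), and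
`SwAll2 ends l h 𝓤₁ 𝓤₂` is `TypedSwAll ends l h 𝓤₁ 𝓤₂ᶜ` (`typedSwAll_iff_swAll2`, TypedRowClasses).
What this file adds to the row of record is its arm principle on g10's class
(`typedSwAll_of_outEdges` through the bridge).  The declarations above are unchanged.
-/
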